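import Summits.Parity.GeneralizedHardyLittlewood.Theorems.FixedShiftLiouvilleLaw.Negative.FixedShiftLiouvilleLawOddShift

/-!
# Birth skeleton (BC3) for the crux `FixedShiftLiouvilleLaw` — route `EntropyRate`, item stmt-Parity-17877

Crux (FIXED, verbatim the route decl `Summit.Parity.GeneralizedHardyLittlewood.Theses.EntropyRate.FixedShiftLiouvilleLaw`):
`∀ h ≥ 1, ∃ c ≠ 0, ∑_{n≤N} Λ(n)Λ(n+h) − 𝔖({0,h})·N − c·∑_{n≤N} λ(n)λ(n+h) = o(N)`.

Line `birth` (skeleton registrar planner-skel-stmt-Parity-17877-0, 2026-08-17) = the route header's own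
TWO-LAYER PLAN for this crux ("FixedShiftLiouvilleLaw ⇐ LiouvilleOpening's cut at slope 1") made into a
checked skeleton, CORRECTED by the birth crux-attack (refuter-rattack-stmt-Parity-17877-0, landed as
`Theorems/FixedShiftLiouvilleLaw/Negative/FixedShiftLiouvilleLawOddShift.lean`, imported here):

* at an ODD shift `𝔖({0,h}) = 0` and `∑ Λ(n)Λ(n+h) ≪ log³ N` (tree `PairsHL.pairsHL_odd`), so — because the
  crux insists on `c ≠ 0` — the law at odd `h` is EQUIVALENT to natural-density binary Chowla at `h`
  (`Negative.law_iff_chowla_of_odd`); the odd half of the crux is therefore typed as what it is,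
  `stub_oddChowla` (on THIS route it is the door's output: `EntropyTransfer PrimeLagChowla
  UniformEntropyRate : ChowlaFixed`, restricted to odd shifts — the same term `closes` already builds);
* at an EVEN shift the content is the fixed-shift instance of the parent crux `LiouvilleOpening.PairLiouvilleLaw`
  (stmt-Parity-16147), and the skeleton is the parent's REGISTERED chart
  (`Cruxes/PairLiouvilleLaw/Lines/birth.lean`) specialised to the shift system `Ψ = (n, n+h)`, `K = [1,N]`:
  the exact split `S_h = MAIN_B + CORE_B` of the Liouville opening `Λ(m) = λ(m)·∑_{e∣m} g(e)`,
  `g(e) = ∑_{k²b=e} μ(k)λ(b) log b`, at level `B = ⌊N^θ⌋`, `θ ∈ (1/2,1)`, then the split of the core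
  into RELATIVE fluctuation and MEAN, and the convergence of the mean coefficient to a NON-ZERO limit:

  `S_h − 𝔖N − c·C_h = (S_h − CORE_B − 𝔖N) + (CORE_B − M_B·C_h) + (M_B − c)·C_h`,

  `C_h(N) = ∑_{n≤N} λ(n)λ(n+h)` (the crux's own Chowla sum, `|C_h(N)| ≤ N`).

Stubs (the ONLY `sorry`s of this file):
* `stub_mainTerm`     — even `h`, `∀ θ ∈ (1/2,1)`: `S_h(N) − CORE_B(N) − 𝔖({0,h})N = o(N)` (XL, unconditional in
  kind: Bombieri–Vinogradov for the `ΛV`-sums over the SMALL complementary divisor `< (N+h)/B ≤ 2N^{1−θ}`,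
  lattice counts for `VV`, signed singular-series main terms re-assembling to `𝔖({0,h})`).
* `stub_coreRelative` — even `h`, `∃ θ ∈ (1/2,1)`: `CORE_B(N) − M_B·C_h(N) = o(N)` — the LOAD-BEARING open stub
  (relative = mean-free equidistribution of `c_h(n) = λ(n)λ(n+h)` on the divisor classes `e₁ ∣ n, e₂ ∣ n+h`,
  `g⊗g`-weighted; moduli `≤ N^{1−δ}`: the fixed-shift RelativeChowlaLevel; window `N^{1−δ} < e₁e₂ ≤ N^{2θ}`:
  DFI bilinear Kloosterman fractions with `λ⊗λ` coefficients).
* `stub_meanLimit`    — even `h`: `M_B → c` as `B → ∞` for some `c ≠ 0` (L; PNT-rate multiplicative number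
  theory; expected value `c = 𝔖({0,h}) > 0`, reviewer R2b on stmt-Parity-16147 and the Goldston–Yıldırım
  singular-series computation; tree `PairsHL.singularSeries_pair_pos_of_even`).
* `stub_oddChowla`    — odd `h ≥ 1`: `∑_{n≤N} λ(n)λ(n+h) = o(N)` (open classically; on this route = the node
  `ChowlaFixed` at odd shifts, i.e. the door's output; Tao 2016 logarithmic, Tao–Teräväinen 2019 a.a. scales).

`FixedShiftLiouvilleLaw_of` (REAL proof, no `sorry`; conclusion literally the route decl): even `h` — `θ` from
Stub 2, Stub 1 at `θ`, `c ≠ 0` and `M_{⌊N^θ⌋} → c` from Stub 3 (`⌊N^θ⌋ → ∞`), `(M_B − c)·C_h = o(1)·O(N) = o(N)`,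
sum of three `o(N)`'s and `ring`; odd `h` — `Negative.law_iff_chowla_of_odd` (landed) applied to Stub 4.

**Hardest stub:** `stub_coreRelative` (contains the fixed-shift relative Chowla level — open at every level;
EH-shaped; its residue-class-uniform form is Siegel-exposed, but the `g⊗g`-AGGREGATE typed here is not refuted in
the illusory world: there `E_h` and `C_h` are both small on the conductor windows (refuter F4:
MatomakiMerikoski2023_fixedShift, TaoTeravainen2021_chowla), hence `CORE_B = o(N) = M_B·C_h + o(N)` given Stub 1).

**Disproof / Negative used** (no `Cruxes/FixedShiftLiouvilleLaw/Disproof.lean` exists at registration; the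
landed Negative file is imported): F1 `law_iff_chowla_of_odd` / `chowla_one_of_fixedShiftLiouvilleLaw` — honoured:
the odd half is an explicit stub (`stub_oddChowla`), not hidden in a "LawOfLevelFixed"; F2
`fixedShiftLiouvilleLaw_iff_pairsHL_of_chowlaFixed` — no stub mentions `PairsHL`, `ChowlaFixed` or the summit;
F3 `fixedShiftLiouvilleLaw_false_without_shiftPos` — every stub keeps `1 ≤ h` (and Stubs 1–3 `Even h`, so
`𝔖({0,h}) > 0`); negatives index (ConvMomentLevelOne, TupleElliott, RectangleChowla): no stub is an instance.

**BC3 audit** (this seat; raw outputs in the seat's NOTES.md `birth-certificate:`): `lean check --json` rc 0,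
sorries = the 4 stubs, zero elsewhere; probes `stub → FixedShiftLiouvilleLaw` and `stub → GeneralizedHardyLittlewood`
by `first | exact? | simpa | aesop` FAIL 8/8.
-/

set_option linter.unusedVariables false

namespace Summit.Parity.GeneralizedHardyLittlewood.Cruxes.FixedShiftLiouvilleLaw.Birth

open scoped BigOperators Topology
open Filter Asymptotics
open Summit.Parity.GeneralizedHardyLittlewood.Theses.EntropyRate
open Summit.Parity.GeneralizedHardyLittlewood.Theorems.FixedShiftLiouvilleLaw.Negative (law_iff_chowla_of_odd)

/-! ### The crux's own objects at a fixed shift `h`, named (each unfolds literally to the crux's inlined terms) -/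

/-- The von Mangoldt pair sum `S_h(N) = ∑_{n ≤ N} Λ(n)Λ(n+h)` — the crux's first term. -/
noncomputable def hlSum (h N : ℕ) : ℝ :=
  ∑ n ∈ Finset.Icc 1 N, ArithmeticFunction.vonMangoldt n * ArithmeticFunction.vonMangoldt (n + h)

/-- The CHOWLA SUM `C_h(N) = ∑_{n ≤ N} λ(n)λ(n+h)` — symbol for symbol the crux's last factor. -/
noncomputable def chowlaSum (h N : ℕ) : ℝ :=
  ∑ n ∈ Finset.Icc 1 N, (((ArithmeticFunction.liouville n * ArithmeticFunction.liouville (n + h) : ℤ)) : ℝ)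

/-- The OPENING COEFFICIENT `g(e) = ∑_{k²b = e} μ(k) λ(b) log b` (`g = μ_□ ⋆ (λ·log)`): the Liouville opening of
von Mangoldt is the exact identity `Λ(m) = λ(m) · ∑_{e ∣ m} g(e)` (complete multiplicativity of `λ`; copied from
the parent skeleton `Cruxes/PairLiouvilleLaw/Lines/birth.lean`). -/
noncomputable def openingCoeff (e : ℕ) : ℝ :=
  ∑ k ∈ Finset.Icc 1 e, ∑ b ∈ Finset.Icc 1 e,
    if k ^ 2 * b = e then
      (ArithmeticFunction.moebius k : ℝ) * (ArithmeticFunction.liouville b : ℝ) * Real.log b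
    else 0

/-- The TRUNCATED COFACTOR WEIGHT `W_B(m) = ∑_{e ∣ m, e ≤ B} g(e)` (divisor-sum weight of level `B`;
`λ(m)·W_∞(m) = Λ(m)`). -/
noncomputable def truncWeight (B m : ℕ) : ℝ :=
  ∑ e ∈ (Nat.divisors m).filter (fun e => e ≤ B), openingCoeff e

/-- The LIOUVILLE CORE of level `B` at shift `h`:
`CORE_B(N) = ∑_{n ≤ N} λ(n)λ(n+h) · W_B(n) W_B(n+h) = ∑_{e₁,e₂ ≤ B} g(e₁)g(e₂) · A_h(e₁,e₂;N)`,
`A_h(e₁,e₂;N) = ∑_{n ≤ N : e₁ ∣ n, e₂ ∣ n+h} λ(n)λ(n+h)` (the Chowla sequence on divisor classes). -/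
noncomputable def coreSum (h N B : ℕ) : ℝ :=
  ∑ n ∈ Finset.Icc 1 N,
    (((ArithmeticFunction.liouville n * ArithmeticFunction.liouville (n + h) : ℤ)) : ℝ) *
      (truncWeight B n * truncWeight B (n + h))

/-- One term of the signed cofactor series of the shift system `(n, n+h)`:
`μ(k) μ(l) λ(b) λ(d) log b log d · dens_h(k²b, l²d)`, `dens_h(e₁,e₂) = #{r mod e₁e₂ : e₁ ∣ r, e₂ ∣ r+h}/(e₁e₂)`
(`= gcd(e₁,e₂)/(e₁e₂)` if `gcd(e₁,e₂) ∣ h`, else `0`). The parent crux's summand at `Ψ = (n, n+h)`. -/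
noncomputable def cofactorTerm (h k l b d : ℕ) : ℝ :=
  (ArithmeticFunction.moebius k : ℝ) * (ArithmeticFunction.moebius l : ℝ) *
    (ArithmeticFunction.liouville b : ℝ) * (ArithmeticFunction.liouville d : ℝ) * Real.log b * Real.log d *
    ((((Finset.range ((k ^ 2 * b) * (l ^ 2 * d))).filter fun r : ℕ =>
        k ^ 2 * b ∣ r ∧ l ^ 2 * d ∣ r + h).card : ℝ) /
      (((k ^ 2 * b) * (l ^ 2 * d) : ℕ) : ℝ))

/-- The LEVEL-`B` MEAN COEFFICIENT `M_B = ∑_{k²b ≤ B, l²d ≤ B} μ(k)μ(l)λ(b)λ(d) log b log d · dens_h(k²b, l²d)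
= ∑_{e₁,e₂ ≤ B} g(e₁)g(e₂) dens_h(e₁,e₂)` — the coefficient of `C_h(N)` the core produces under relative
equidistribution. -/
noncomputable def levelMean (h B : ℕ) : ℝ :=
  ∑ k ∈ Finset.Icc 1 B, ∑ l ∈ Finset.Icc 1 B, ∑ b ∈ Finset.Icc 1 B, ∑ d ∈ Finset.Icc 1 B,
    if k ^ 2 * b ≤ B ∧ l ^ 2 * d ≤ B then cofactorTerm h k l b d else 0

/-! ### Bookkeeping lemmas used by the composition (all sorry-free) -/

/-- `|λ(m)| ≤ 1` (`λ(0) = 0`). [folklore] -/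
theorem abs_liouville_cast_le_one (m : ℕ) : |((ArithmeticFunction.liouville m : ℤ) : ℝ)| ≤ 1 := by
  rcases eq_or_ne m 0 with rfl | hm
  · simp
  · rw [ArithmeticFunction.liouville_apply hm]
    push_cast
    rw [abs_pow, abs_neg, abs_one, one_pow]

/-- The trivial bound `|C_h(N)| ≤ N`. [bookkeeping] -/
theorem abs_chowlaSum_le (h N : ℕ) : |chowlaSum h N| ≤ N := by
  unfold chowlaSum
  refine (Finset.abs_sum_le_sum_abs _ _).trans ?_
  refine (Finset.sum_le_card_nsmul _ _ 1 ?_).trans ?_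
  · intro n _
    push_cast
    rw [abs_mul]
    exact mul_le_one₀ (abs_liouville_cast_le_one n) (abs_nonneg _) (abs_liouville_cast_le_one (n + h))
  · simp

/-- `⌊N^θ⌋ → ∞` for `θ > 0`. [bookkeeping] -/
theorem tendsto_floor_rpow {θ : ℝ} (hθ : 0 < θ) :
    Tendsto (fun N : ℕ => ⌊(N : ℝ) ^ θ⌋₊) atTop atTop :=
  tendsto_nat_floor_atTop.comp ((tendsto_rpow_atTop hθ).comp tendsto_natCast_atTop_atTop)

/-- The third bracket: `(M_{⌊N^θ⌋} − c) · C_h(N) = o(1) · O(N) = o(N)`. [bookkeeping] -/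
theorem meanTail_isLittleO {h : ℕ} {θ c : ℝ} (hθ : 0 < θ)
    (hc : Tendsto (fun B : ℕ => levelMean h B) atTop (𝓝 c)) :
    (fun N : ℕ => (levelMean h ⌊(N : ℝ) ^ θ⌋₊ - c) * chowlaSum h N) =o[atTop] fun N : ℕ => (N : ℝ) := by
  have h1 : Tendsto (fun N : ℕ => levelMean h ⌊(N : ℝ) ^ θ⌋₊ - c) atTop (𝓝 0) :=
    tendsto_sub_nhds_zero_iff.mpr (hc.comp (tendsto_floor_rpow hθ))
  have h2 : (fun N : ℕ => levelMean h ⌊(N : ℝ) ^ θ⌋₊ - c) =o[atTop] (fun _ : ℕ => (1 : ℝ)) :=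
    (isLittleO_one_iff ℝ).mpr h1
  have h3 : (fun N : ℕ => chowlaSum h N) =O[atTop] (fun N : ℕ => (N : ℝ)) := by
    refine IsBigO.of_bound 1 (Eventually.of_forall fun N => ?_)
    have hN : ‖(N : ℝ)‖ = N := by
      rw [Real.norm_eq_abs]
      exact abs_of_nonneg (Nat.cast_nonneg N)
    rw [Real.norm_eq_abs, hN, one_mul]
    exact abs_chowlaSum_le h N
  simpa using h2.mul_isBigO h3

/-! ### The four registered stubs (the ONLY `sorry`s of this file) -/

/-- **Stub 1 — MAIN TERM at an even fixed shift (`MAIN_B = S_h − CORE_B ≈ 𝔖({0,h})·N`; unconditional in kind,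
XL).** For even `h ≥ 1` and every truncation exponent `θ ∈ (1/2, 1)` (level `B = ⌊N^θ⌋`):
`∑_{n≤N} Λ(n)Λ(n+h) − CORE_B(N) − 𝔖({0,h})·N = o(N)`. Why plausibly true: by the opening identity
`Λ = λ·W_∞`, `S_h − CORE_B = ∑ Λ(n)V(n+h) + ∑ V(n)Λ(n+h) − ∑ V(n)V(n+h)` with
`V(m) = λ(m)(W_∞ − W_B)(m) = ∑_{fk² ∣ m, m/(fk²) > B} λ(f)μ(k) log(m/(fk²))` opened through the SMALL
complementary divisor `fk² < m/B ≤ 2N^{1−θ}`: the `ΛV` sums are primes in progressions to moduli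
`≤ 2N^{1−θ}(log N)^{2C}` (square layers `k ≤ (log N)^C`, larger `k` trivially) — Bombieri–Vinogradov, level
`< N^{1/2}` exactly because `θ > 1/2` (tree: `BombieriVinogradovStatement_holds`); `VV` is lattice-point counting
with log-weights to moduli `≤ N^{2(1−θ)+o(1)} < N`; the resulting `λ`/`μ`-SIGNED singular-series main terms are
complete up to PNT-rate tails and must re-assemble to `𝔖({0,h})` (Goldston–Yıldırım `Λ_R`-correlation
bookkeeping). Why it might fail: only through that BOOKKEEPING (a local-factor slip at `p ∣ h` or `p = 2`
would put a wrong constant in front of `N` — the parent crux's own kill criterion "misstated constant");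
no parity content (BV for primes + signed singular series are parity-insensitive). Size: XL. Leans on:
`Literature.NumberTheory.Sieve.singularSeries` (tree), Bombieri–Vinogradov (tree),
`tendsto_singularSeriesPartial_holds`. [cite: GoldstonYildirim2003 (arXiv:math/0111212) Lemma 2.1;
MurtyVatwani2017; Vatwani2016 ch. 7; IwaniecKowalski2004 Thm 17.1] -/
theorem stub_mainTerm :
    ∀ h : ℕ, 1 ≤ h → Even h → ∀ θ : ℝ, 1 / 2 < θ → θ < 1 →
      (fun N : ℕ => hlSum h N - coreSum h N ⌊(N : ℝ) ^ θ⌋₊ -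
          Literature.NumberTheory.Sieve.singularSeries ({0, (h : ℤ)} : Finset ℤ) * N) =o[Filter.atTop]
        fun N : ℕ => (N : ℝ) := by
  sorry

/-- **Stub 2 — RELATIVE CORE LAW at an even fixed shift (`CORE_B ≈ M_B · C_h`; the LOAD-BEARING, open stub).**
For even `h ≥ 1` there is a truncation exponent `θ ∈ (1/2, 1)` (the prover's choice, just above `1/2`) with
`CORE_B(N) − M_B·∑_{n≤N} λ(n)λ(n+h) = o(N)`, `B = ⌊N^θ⌋`. MEAN-FREE: writing
`CORE_B = ∑_{e₁,e₂ ≤ B} g(e₁)g(e₂) A_h(e₁,e₂;N)`, the stub says `A_h(e₁,e₂;N) ≈ dens_h(e₁,e₂)·C_h(N)` on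
`g⊗g`-average — RELATIVE equidistribution of the Chowla sequence `c_h(n) = λ(n)λ(n+h)` on the divisor classes;
a biased i.i.d. model of `c_h` passes it (parity-neutral), and nothing is claimed about the size of `C_h` itself.
The plan inside (route EntropyRate TWO-LAYER PLAN "RelativeChowlaLevelFixed → LawOfLevelFixed"; parent items
`LiouvilleOpening.RelativeChowlaLevel` stmt-Parity-16148 / `LawOfLevel` stmt-Parity-16151 at slope 1): moduli
`e₁e₂ ≤ N^{1−δ}` by a fixed-shift relative level of distribution of `c_h` (saving `(log N)^{−A}` against the
`log²` and divisor weights of `g`); the BALANCED WINDOW `N^{1−δ} < e₁e₂ ≤ B² = N^{2θ}` by the complementary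
variables `(f₁,f₂)`, `e₁f₁ = n`, `e₂f₂ = n + h`, solving the determinant equation `e₂f₂ − e₁f₁ = h` with
`λ(f₁)λ(f₂)` coefficients — Duke–Friedlander–Iwaniec bilinear Kloosterman fractions (tree:
`Literature.NumberTheory.LFunctions.DukeFriedlanderIwaniec1997_bilinearKloostermanFractions_holds`, saving
positive iff `θ < 6/11`). Why it might fail: it contains the fixed-shift relative Chowla level in substance —
open at every level (Tao 2016 is logarithmic, Tao–Teräväinen 2019 almost-all-scales, and both are about the
MEAN, not the classes); its residue-uniform form is Siegel-exposed (`c_h ≈ χ(n(n+h))` is biased on classes mod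
`q_exc`), although the aggregate typed here survives the illusory world (there `E_h`, `C_h` are both small:
refuter F4 on the item); and the window needs DFI with MULTIPLICATIVE (`λ⊗λ`) coefficients only in the ranges
DFI covers — the band between the BV range and the balanced box may need a dispersion input not in print.
In a world with HL(h) true and Chowla(h) false it is FALSE (then `CORE_B = o(N)` by Stub 1 but `M_B C_h ≍ N`) —
exactly the crux's own why-might-fail. Size: open problem. [cite: TaoFMP2016 (arXiv:1509.05422);
TaoTeravainenDuke2019 (arXiv:1809.02518); MatomakiRadziwillTao2015; DukeFriedlanderIwaniec1997 Thm 2;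
BettinChandee2018; MurtyVatwani2017; Polymath8b2014 §8] -/
theorem stub_coreRelative :
    ∀ h : ℕ, 1 ≤ h → Even h → ∃ θ : ℝ, 1 / 2 < θ ∧ θ < 1 ∧
      (fun N : ℕ => coreSum h N ⌊(N : ℝ) ^ θ⌋₊ - levelMean h ⌊(N : ℝ) ^ θ⌋₊ * chowlaSum h N) =o[Filter.atTop]
        fun N : ℕ => (N : ℝ) := by
  sorry

/-- **Stub 3 — THE MEAN COEFFICIENT CONVERGES TO A NON-ZERO CONSTANT (even fixed shift; L).** For even `h ≥ 1`
the level-truncated signed cofactor sums `M_B = ∑_{e₁,e₂ ≤ B} g(e₁)g(e₂)dens_h(e₁,e₂)` converge, as `B → ∞`, to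
some `c ≠ 0` — the crux's constant `c_h`. Why plausibly true: `g(e) = μ(e) log e` on squarefree `e` (plus
square-layer corrections), `dens_h(e₁,e₂) = gcd(e₁,e₂)·𝟙[gcd ∣ h]/(e₁e₂)`; the two-variable Dirichlet series
`F(s₁,s₂) = ∑ μ(e₁)μ(e₂)dens_h e₁^{−s₁}e₂^{−s₂}` has, for `h ≠ 0`, local factors `1 − p^{−1−s₁} − p^{−1−s₂}` at
`p ∤ h` (NO diagonal pole, unlike `h = 0`), so `F ≈ s₁s₂·E(s₁,s₂)` with `E` holomorphic near `0` and the logged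
sum converges (conditionally, by the prime number theorem for `μ`, `λ` with the classical zero-free region:
`∑ μ(e) log e/e = −1`, `∑ λ(b) log b/b = −ζ(2)`) to `E(0,0)`; the Goldston–Yıldırım singular-series computation
and the reviewer's note R2b on the parent item stmt-Parity-16147 (`∑_{k²b=p^a} μ(k)λ(b) = μ(p^a)` makes the local
factor `β_p`) identify the limit as `𝔖({0,h})`, which is `> 0` for even `h` (tree:
`PairsHL.singularSeries_pair_pos_of_even`). Why it might fail: conditional convergence only (the ORDER — level
truncation `k²b ≤ B` — matters in the proof, not in the limit); a vanishing limit at some even `h` (a local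
factor `0` at `p = 2` from the square layers) would make the crux false as typed at that shift. Typed with
`Tendsto`, so non-convergence makes the stub FALSE, never junk. Size: L. Leans on: Mathlib
`ArithmeticFunction.moebius/liouville`, PNT-rate Möbius/Liouville sums (tree: Literature
`LiouvilleSumClassicalBound`, `SingularSeries`). [cite: GoldstonYildirim2003 (arXiv:math/0111212) Lemma 2.1;
MontgomeryVaughan2007 §6.2, §11.3; GreenTao2010 Lemma 1.3] -/
theorem stub_meanLimit :
    ∀ h : ℕ, 1 ≤ h → Even h → ∃ c : ℝ, c ≠ 0 ∧
      Filter.Tendsto (fun B : ℕ => levelMean h B) Filter.atTop (nhds c) := by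
  sorry

/-- **Stub 4 — NATURAL-DENSITY BINARY CHOWLA AT ODD SHIFTS (`∑_{n≤N} λ(n)λ(n+h) = o(N)`, `h` odd).** This is what
the crux's odd half IS (`Negative.law_iff_chowla_of_odd`: at odd `h`, `𝔖({0,h}) = 0` and `∑ Λ(n)Λ(n+h) ≪ log³ N`,
so with `c ≠ 0` the law ⟺ Chowla). Why plausibly true: it is the binary Chowla conjecture at odd shifts —
logarithmically averaged it is Tao's theorem (arXiv:1509.05422), at almost all scales Tao–Teräväinen
(arXiv:1809.02518); on THIS route it is not extra content: it is the node `ChowlaFixed` (stmt-Parity-17879)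
restricted to odd shifts, i.e. the output `EntropyTransfer PrimeLagChowla UniformEntropyRate` of the door,
the very term `closes` already builds — a prover of the crux on this route discharges it by
`fun h h1 _ => hT hM hE h h1`. Why it might fail: natural-density two-point Chowla is open (removing the
logarithmic average is blocked for soft reasons, `Literature.Barriers.Parity.LogarithmicAveraging`); it fails in
no known model world but is unprovable by anything in the tree. Size: open problem (= the route's door chain).
[cite: TaoFMP2016 (arXiv:1509.05422) Thm 1.1; TaoTeravainenDuke2019 (arXiv:1809.02518) Thm 1.17;
HelfgottRadziwill2021 (arXiv:2103.06853); Chowla1965] -/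
theorem stub_oddChowla :
    ∀ h : ℕ, 1 ≤ h → Odd h →
      (fun N : ℕ => ∑ n ∈ Finset.Icc 1 N, (((ArithmeticFunction.liouville n *
          ArithmeticFunction.liouville (n + h) : ℤ)) : ℝ)) =o[Filter.atTop] fun N : ℕ => (N : ℝ) := by
  sorry

/-! ### Stub signatures as propositions (verbatim the statements above; named `Sig.stub_<name>` so that the
composition's hypotheses are the registered stubs BY NAME for the skeleton audit) -/

/-- Signature of `stub_mainTerm`. -/
def Sig.stub_mainTerm : Prop :=
    ∀ h : ℕ, 1 ≤ h → Even h → ∀ θ : ℝ, 1 / 2 < θ → θ < 1 →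
      (fun N : ℕ => hlSum h N - coreSum h N ⌊(N : ℝ) ^ θ⌋₊ -
          Literature.NumberTheory.Sieve.singularSeries ({0, (h : ℤ)} : Finset ℤ) * N) =o[Filter.atTop]
        fun N : ℕ => (N : ℝ)

/-- Signature of `stub_coreRelative`. -/
def Sig.stub_coreRelative : Prop :=
    ∀ h : ℕ, 1 ≤ h → Even h → ∃ θ : ℝ, 1 / 2 < θ ∧ θ < 1 ∧
      (fun N : ℕ => coreSum h N ⌊(N : ℝ) ^ θ⌋₊ - levelMean h ⌊(N : ℝ) ^ θ⌋₊ * chowlaSum h N) =o[Filter.atTop]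
        fun N : ℕ => (N : ℝ)

/-- Signature of `stub_meanLimit`. -/
def Sig.stub_meanLimit : Prop :=
    ∀ h : ℕ, 1 ≤ h → Even h → ∃ c : ℝ, c ≠ 0 ∧
      Filter.Tendsto (fun B : ℕ => levelMean h B) Filter.atTop (nhds c)

/-- Signature of `stub_oddChowla`. -/
def Sig.stub_oddChowla : Prop :=
    ∀ h : ℕ, 1 ≤ h → Odd h →
      (fun N : ℕ => ∑ n ∈ Finset.Icc 1 N, (((ArithmeticFunction.liouville n *
          ArithmeticFunction.liouville (n + h) : ℤ)) : ℝ)) =o[Filter.atTop] fun N : ℕ => (N : ℝ)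

/-! ### Composition: the four stubs prove the crux BY NAME (real proof, no `sorry`) -/

/-- **BC3 composition.** `stub_mainTerm → stub_coreRelative → stub_meanLimit → stub_oddChowla →
FixedShiftLiouvilleLaw`, the conclusion being literally the route decl
`Summit.Parity.GeneralizedHardyLittlewood.Theses.EntropyRate.FixedShiftLiouvilleLaw`. Even `h`: the exact split
`S − 𝔖N − cC = (S − CORE_B − 𝔖N) + (CORE_B − M_B C) + (M_B − c)·C` with `θ` from Stub 2, the witness `c ≠ 0` of
Stub 3 and `(M_B − c)C = o(N)` (`meanTail_isLittleO`); odd `h`: `law_iff_chowla_of_odd` (landed Negative lemma)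
and Stub 4. -/
theorem FixedShiftLiouvilleLaw_of :
    Sig.stub_mainTerm → Sig.stub_coreRelative → Sig.stub_meanLimit → Sig.stub_oddChowla →
      Summit.Parity.GeneralizedHardyLittlewood.Theses.EntropyRate.FixedShiftLiouvilleLaw := by
  intro hMain hCore hMean hOdd h hh
  rcases Nat.even_or_odd h with he | ho
  · obtain ⟨θ, hθ₁, hθ₂, h2⟩ := hCore h hh he
    have h1 := hMain h hh he θ hθ₁ hθ₂
    obtain ⟨c, hc0, hcT⟩ := hMean h hh he
    have hθ0 : 0 < θ := by linarith
    have h3 := meanTail_isLittleO (h := h) (c := c) hθ0 hcT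
    refine ⟨c, hc0, ?_⟩
    refine ((h1.add h2).add h3).congr' (Eventually.of_forall fun N => ?_) EventuallyEq.rfl
    simp only [hlSum, chowlaSum]
    ring
  · exact (law_iff_chowla_of_odd ho).mpr (hOdd h hh ho)

/-- The skeleton in its final shape: the crux BY NAME from the four registered stubs (it becomes a proof of
the crux when the last `stub_*` is discharged; until then it depends on `sorryAx` through the stubs only — no
`sorry` of its own). [bookkeeping] -/
theorem FixedShiftLiouvilleLaw_proof :
    Summit.Parity.GeneralizedHardyLittlewood.Theses.EntropyRate.FixedShiftLiouvilleLaw :=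
  FixedShiftLiouvilleLaw_of stub_mainTerm stub_coreRelative stub_meanLimit stub_oddChowla

end Summit.Parity.GeneralizedHardyLittlewood.Cruxes.FixedShiftLiouvilleLaw.Birth
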